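import Summits.Ventures.DiscreteObjects.Hadamard.HadamardCodeModQ
import Summits.Ventures.DiscreteObjects.Hadamard.ParityPermModule29

/-!
# Kernel dimensions of polynomials in a signed permutation: support splitting and vanishing (kernel)

Framing: lottery ticket; floor = certified bounds/negative ranges.

Cell pub-namedobj (venture DiscreteObjects), target (H), hadamard gen 15.  For the signed pull-back `(Kt v) j = e j · v (κ j)` of a
signed permutation `(κ, e)` of a finite type `ι` over a field `F` (`T = Kt` as an endomorphism of `ι → F`) and a polynomial
`h`, the even-multiplicity theorem (`HadamardSignedAutParity`) speaks about `dim ker h(T)`.  This file turns that dimension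
into cycle data:
* `signedPullback_aeval_apply` — `(h(T) v) j = Σ_k h_k (∏_{i<k} e(κ^i j)) v(κ^k j)`;
* `cycleSign_apply_pow` — the cycle sign `ε_j = ∏_{i<L} e(κ^i j)` (`κ^L j = j`) is constant along the cycle;
* `finrank_ker_inf_supp_split` — SUPPORT SPLITTING: for `κ`-stable finsets `A, S`,
  `dim (ker h(T) ∩ V_A) = dim (ker h(T) ∩ V_{A ∩ S}) + dim (ker h(T) ∩ V_{A \ S})`, where `V_X = {v | v = 0 off X}`
  (written `Submodule.pi {j | j ∉ X} ⊥`);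
* `ker_aeval_apply_eq_zero_of_isCoprime` — VANISHING: if `h` is coprime to `X^{L_j} - ε_j` (`L_j` the period of `j`), every
  `v ∈ ker h(T)` has `v j = 0`; hence `ker h(T) ∩ V_S = 0` when this holds on `S` (`ker_inf_supp_eq_bot_of_isCoprime`).
The exact count on a class of cycles of constant length and sign is `SignedCycleClassCount`.  Elementary; ours; no `sorry`.
-/

open Polynomial Finset BigOperators Matrix

namespace Summit.Ventures.DiscreteObjects.Hadamard

variable {F : Type*} [Field F] {ι : Type*} [Fintype ι] [DecidableEq ι]

section formulas
variable (κ : Equiv.Perm ι) (ee : ι → F) (Kt : Matrix ι ι F)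

/-- **pointwise formula** for a polynomial in the signed pull-back -/
theorem signedPullback_aeval_apply (hKt : Kt = Matrix.of fun j k => if k = κ j then ee j else 0) (g : F[X])
    (v : ι → F) (j : ι) :
    aeval (Matrix.toLinAlgEquiv' Kt) g v j =
      ∑ k ∈ range (g.natDegree + 1), g.coeff k * ((∏ i ∈ range k, ee ((κ ^ i) j)) * v ((κ ^ k) j)) := by
  rw [aeval_eq_sum_range, LinearMap.sum_apply, Finset.sum_apply]
  refine Finset.sum_congr rfl fun k _ => ?_
  rw [LinearMap.smul_apply, Pi.smul_apply, smul_eq_mul, ← map_pow, Matrix.toLinAlgEquiv'_apply,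
    signedPullback_pow_mulVec κ ee Kt hKt]

/-- `(X^L - C ε)(T) v` pointwise -/
lemma signedPullback_X_pow_sub_C_apply (hKt : Kt = Matrix.of fun j k => if k = κ j then ee j else 0) (L : ℕ) (ε : F)
    (v : ι → F) (j : ι) :
    aeval (Matrix.toLinAlgEquiv' Kt) (X ^ L - C ε) v j = (∏ i ∈ range L, ee ((κ ^ i) j)) * v ((κ ^ L) j) - ε * v j := by
  rw [map_sub, map_pow, aeval_X, aeval_C, LinearMap.sub_apply, Pi.sub_apply, ← map_pow, Matrix.toLinAlgEquiv'_apply,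
    signedPullback_pow_mulVec κ ee Kt hKt, Module.algebraMap_end_apply, Pi.smul_apply, smul_eq_mul]

variable {κ ee}

omit [Fintype ι] [DecidableEq ι] in
/-- one step along a cycle does not change the cycle sign (`κ^L j = j`, signs nonzero) -/
lemma cycleSign_apply (hee : ∀ j, ee j * ee j = 1) {L : ℕ} {j : ι} (hj : (κ ^ L) j = j) :
    ∏ i ∈ range L, ee ((κ ^ i) (κ j)) = ∏ i ∈ range L, ee ((κ ^ i) j) := by
  have e1 : ∏ i ∈ range (L + 1), ee ((κ ^ i) j) = (∏ i ∈ range L, ee ((κ ^ i) (κ j))) * ee j := by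
    rw [Finset.prod_range_succ']
    simp only [pow_zero, Equiv.Perm.one_apply, pow_succ, Equiv.Perm.mul_apply]
  have e2 : ∏ i ∈ range (L + 1), ee ((κ ^ i) j) = (∏ i ∈ range L, ee ((κ ^ i) j)) * ee j := by
    rw [Finset.prod_range_succ, hj]
  have hne : ee j ≠ 0 := fun h0 => by have := hee j; rw [h0, zero_mul] at this; exact zero_ne_one this
  exact mul_right_cancel₀ hne (e1.symm.trans e2)

omit [Fintype ι] [DecidableEq ι] in
/-- the cycle sign is constant along the cycle -/
theorem cycleSign_apply_pow (hee : ∀ j, ee j * ee j = 1) {L : ℕ} {j : ι} (hj : (κ ^ L) j = j) (t : ℕ) :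
    ∏ i ∈ range L, ee ((κ ^ i) ((κ ^ t) j)) = ∏ i ∈ range L, ee ((κ ^ i) j) := by
  induction t with
  | zero => simp
  | succ t ih =>
    have hjt : (κ ^ L) ((κ ^ t) j) = (κ ^ t) j := by
      rw [← Equiv.Perm.mul_apply, ← pow_add, add_comm, pow_add, Equiv.Perm.mul_apply, hj]
    rw [pow_succ', Equiv.Perm.mul_apply, cycleSign_apply hee hjt, ih]

omit [Fintype ι] [DecidableEq ι] in
/-- periodicity transported along the cycle: `κ^L (κ^t j) = κ^t j` -/
lemma pow_apply_pow_of_fixed {L : ℕ} {j : ι} (hj : (κ ^ L) j = j) (t : ℕ) : (κ ^ L) ((κ ^ t) j) = (κ ^ t) j := by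
  rw [← Equiv.Perm.mul_apply, ← pow_add, add_comm, pow_add, Equiv.Perm.mul_apply, hj]

end formulas

section vanishing
variable (κ : Equiv.Perm ι) (ee : ι → F) (Kt : Matrix ι ι F)

/-- **Vanishing.**  If `κ^L j = j` and `h` is coprime to `X^L - C ε_j` with `ε_j = ∏_{i<L} e(κ^i j)`, then every
`v ∈ ker h(T)` vanishes at `j`. -/
theorem ker_aeval_apply_eq_zero_of_isCoprime (hee : ∀ j, ee j * ee j = 1)
    (hKt : Kt = Matrix.of fun j k => if k = κ j then ee j else 0) {h : F[X]} {L : ℕ} {j : ι} (hj : (κ ^ L) j = j)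
    (hcop : IsCoprime h (X ^ L - C (∏ i ∈ range L, ee ((κ ^ i) j)))) {v : ι → F}
    (hv : aeval (Matrix.toLinAlgEquiv' Kt) h v = 0) : v j = 0 := by
  set T := Matrix.toLinAlgEquiv' Kt with hT
  set ε := ∏ i ∈ range L, ee ((κ ^ i) j) with hε
  obtain ⟨a, b, hab⟩ := hcop
  -- w := (X^L - C ε)(T) v vanishes along the cycle of j
  have hw : ∀ t : ℕ, aeval T (X ^ L - C ε) v ((κ ^ t) j) = 0 := by
    intro t
    rw [hT, signedPullback_X_pow_sub_C_apply κ ee Kt hKt, cycleSign_apply_pow hee hj t, pow_apply_pow_of_fixed hj t, ← hε,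
      sub_self]
  -- v = b(T) w, and (b(T) w) j only sees w on the cycle
  have hv' : v = aeval T b (aeval T (X ^ L - C ε) v) := by
    have e := congrArg (fun p => aeval T p v) hab
    simp only [map_add, map_mul, map_one, LinearMap.add_apply, Module.End.mul_apply, Module.End.one_apply, hv,
      map_zero, zero_add] at e
    exact e.symm
  rw [hv', hT, signedPullback_aeval_apply κ ee Kt hKt]
  refine Finset.sum_eq_zero fun k _ => ?_
  rw [← hT, hw k, mul_zero, mul_zero]

/-- hence `ker h(T) ∩ V_S = 0` when the coprimality holds at every point of `S` -/
theorem ker_inf_supp_eq_bot_of_isCoprime (hee : ∀ j, ee j * ee j = 1)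
    (hKt : Kt = Matrix.of fun j k => if k = κ j then ee j else 0) {h : F[X]} (S : Finset ι) (L : ι → ℕ)
    (hL : ∀ j ∈ S, (κ ^ L j) j = j)
    (hcop : ∀ j ∈ S, IsCoprime h (X ^ L j - C (∏ i ∈ range (L j), ee ((κ ^ i) j)))) :
    LinearMap.ker (aeval (Matrix.toLinAlgEquiv' Kt) h) ⊓ Submodule.pi {j | j ∉ S} (fun _ => (⊥ : Submodule F F)) = ⊥ := by
  rw [eq_bot_iff]
  intro v hv
  obtain ⟨hv1, hv2⟩ := Submodule.mem_inf.mp hv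
  rw [Submodule.mem_bot]
  funext j
  by_cases hjS : j ∈ S
  · exact ker_aeval_apply_eq_zero_of_isCoprime κ ee Kt hee hKt (hL j hjS) (hcop j hjS) (LinearMap.mem_ker.mp hv1)
  · exact (Submodule.mem_bot F).mp (Submodule.mem_pi.mp hv2 j hjS)

end vanishing

section splitting
variable (κ : Equiv.Perm ι) (ee : ι → F) (Kt : Matrix ι ι F)

omit [Fintype ι] [DecidableEq ι] in
/-- membership in the support submodule `V_X = {v | v = 0 off X}` -/
lemma mem_supp_iff (X : Finset ι) (v : ι → F) :
    v ∈ Submodule.pi {j | j ∉ X} (fun _ => (⊥ : Submodule F F)) ↔ ∀ j, j ∉ X → v j = 0 := by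
  rw [Submodule.mem_pi]
  exact forall_congr' fun j => by rw [Set.mem_setOf_eq, Submodule.mem_bot]

/-- the indicator multiplication `v ↦ 𝟙_S · v` commutes with the signed pull-back when `S` is `κ`-stable -/
lemma indicator_comm (hKt : Kt = Matrix.of fun j k => if k = κ j then ee j else 0) (S : Finset ι)
    (hS : ∀ j, κ j ∈ S ↔ j ∈ S) :
    LinearMap.mulLeft F (fun j => if j ∈ S then (1 : F) else 0) ∘ₗ (Matrix.toLinAlgEquiv' Kt : (ι → F) →ₗ[F] (ι → F)) =
      (Matrix.toLinAlgEquiv' Kt : (ι → F) →ₗ[F] (ι → F)) ∘ₗ LinearMap.mulLeft F (fun j => if j ∈ S then (1 : F) else 0) := by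
  refine LinearMap.ext fun v => funext fun j => ?_
  rw [LinearMap.comp_apply, LinearMap.comp_apply, LinearMap.mulLeft_apply, LinearMap.mulLeft_apply, Pi.mul_apply,
    Matrix.toLinAlgEquiv'_apply, Matrix.toLinAlgEquiv'_apply, signedPullback_mulVec κ ee Kt hKt,
    signedPullback_mulVec κ ee Kt hKt, Pi.mul_apply]
  simp only [hS j]
  ring

/-- **Support splitting.**  For `κ`-stable finsets `A` and `S`:
`dim (ker h(T) ∩ V_A) = dim (ker h(T) ∩ V_{A ∩ S}) + dim (ker h(T) ∩ V_{A \ S})`. -/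
theorem finrank_ker_inf_supp_split (hKt : Kt = Matrix.of fun j k => if k = κ j then ee j else 0) (h : F[X])
    (A S : Finset ι) (hS : ∀ j, κ j ∈ S ↔ j ∈ S) :
    Module.finrank F ↥(LinearMap.ker (aeval (Matrix.toLinAlgEquiv' Kt) h) ⊓
        Submodule.pi {j | j ∉ A} (fun _ => (⊥ : Submodule F F))) =
      Module.finrank F ↥(LinearMap.ker (aeval (Matrix.toLinAlgEquiv' Kt) h) ⊓
          Submodule.pi {j | j ∉ A ∩ S} (fun _ => (⊥ : Submodule F F))) +
        Module.finrank F ↥(LinearMap.ker (aeval (Matrix.toLinAlgEquiv' Kt) h) ⊓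
          Submodule.pi {j | j ∉ A \ S} (fun _ => (⊥ : Submodule F F))) := by
  set T : (ι → F) →ₗ[F] (ι → F) := Matrix.toLinAlgEquiv' Kt with hT
  set K := LinearMap.ker (aeval T h) with hK
  set W := K ⊓ Submodule.pi {j | j ∉ A} (fun _ => (⊥ : Submodule F F)) with hW
  set W₁ := K ⊓ Submodule.pi {j | j ∉ A ∩ S} (fun _ => (⊥ : Submodule F F)) with hW₁
  set W₂ := K ⊓ Submodule.pi {j | j ∉ A \ S} (fun _ => (⊥ : Submodule F F)) with hW₂
  set P : (ι → F) →ₗ[F] (ι → F) := LinearMap.mulLeft F (fun j => if j ∈ S then (1 : F) else 0) with hP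
  have hP_apply : ∀ v j, P v j = if j ∈ S then v j else 0 := by
    intro v j
    rw [hP, LinearMap.mulLeft_apply, Pi.mul_apply]
    split_ifs <;> simp
  have hPT : P ∘ₗ T = T ∘ₗ P := indicator_comm κ ee Kt hKt S hS
  have hPK : ∀ v ∈ K, P v ∈ K := by
    intro v hv
    rw [hK, LinearMap.mem_ker] at hv ⊢
    rw [← aeval_apply_of_comp_eq T T P hPT h v, hv, map_zero]
  -- W = W₁ ⊔ W₂
  have hsup : W₁ ⊔ W₂ = W := by
    apply le_antisymm
    · rw [sup_le_iff]
      constructor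
      · rintro v ⟨hv1, hv2⟩
        refine Submodule.mem_inf.mpr ⟨hv1, (mem_supp_iff _ v).mpr fun j hj => ?_⟩
        exact (mem_supp_iff _ v).mp hv2 j (fun h' => hj (Finset.mem_inter.mp h').1)
      · rintro v ⟨hv1, hv2⟩
        refine Submodule.mem_inf.mpr ⟨hv1, (mem_supp_iff _ v).mpr fun j hj => ?_⟩
        exact (mem_supp_iff _ v).mp hv2 j (fun h' => hj (Finset.mem_sdiff.mp h').1)
    · intro v hv
      obtain ⟨hv1, hv2⟩ := Submodule.mem_inf.mp hv
      have hvA := (mem_supp_iff A v).mp hv2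
      have e : v = P v + (v - P v) := by abel
      rw [e]
      refine Submodule.add_mem_sup ?_ ?_
      · refine Submodule.mem_inf.mpr ⟨hPK v hv1, (mem_supp_iff _ _).mpr fun j hj => ?_⟩
        rw [hP_apply]
        split_ifs with hjS
        · exact hvA j (fun hjA => hj (Finset.mem_inter.mpr ⟨hjA, hjS⟩))
        · rfl
      · refine Submodule.mem_inf.mpr ⟨Submodule.sub_mem _ hv1 (hPK v hv1), (mem_supp_iff _ _).mpr fun j hj => ?_⟩
        rw [Pi.sub_apply, hP_apply]
        split_ifs with hjS
        · exact sub_self _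
        · rw [sub_zero]
          exact hvA j (fun hjA => hj (Finset.mem_sdiff.mpr ⟨hjA, hjS⟩))
  -- W₁ ⊓ W₂ = ⊥
  have hinf : W₁ ⊓ W₂ = ⊥ := by
    rw [eq_bot_iff]
    intro v hv
    obtain ⟨h1, h2⟩ := Submodule.mem_inf.mp hv
    rw [Submodule.mem_bot]
    funext j
    by_cases hjS : j ∈ S
    · exact (mem_supp_iff _ v).mp (Submodule.mem_inf.mp h2).2 j (fun h' => (Finset.mem_sdiff.mp h').2 hjS)
    · exact (mem_supp_iff _ v).mp (Submodule.mem_inf.mp h1).2 j (fun h' => hjS (Finset.mem_inter.mp h').2)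
  have e := Submodule.finrank_sup_add_finrank_inf_eq W₁ W₂
  rw [hsup, hinf, finrank_bot, add_zero] at e
  exact e

/-- the whole space is `V_univ` -/
lemma ker_inf_supp_univ (h : F[X]) :
    LinearMap.ker (aeval (Matrix.toLinAlgEquiv' Kt) h) ⊓ Submodule.pi {j | j ∉ (Finset.univ : Finset ι)}
        (fun _ => (⊥ : Submodule F F)) = LinearMap.ker (aeval (Matrix.toLinAlgEquiv' Kt) h) := by
  apply le_antisymm inf_le_left
  intro v hv
  exact Submodule.mem_inf.mpr ⟨hv, (mem_supp_iff _ v).mpr fun j hj => absurd (Finset.mem_univ j) hj⟩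

end splitting

end Summit.Ventures.DiscreteObjects.Hadamard
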